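import Summits.KontsevichZagierPeriods.KontsevichZagierPeriods.Theorems.GpcLegendreLemniscatic.Negative.Canonical
import Literature.NumberTheory.Transcendental.KZLogCalculusProofs

/-!
# `LegendreAllModuli` (stmt-KontsevichZagierPeriods-3523), line `Sketch` — stub M3 `stub_discToStrip`

ONE rule-(2) move (change of variables) of the Kontsevich–Zagier calculus
[Kontsevich–Zagier 2001, §1.2 rule (2)] along the one-coordinate substitution
`Θ z = update z 0 (θ z)`, `θ z = z0·√(1 − z1²)/√(1 + z0²)`, a bijection of the half-strip
`H = {0 < z0} ∩ {0 < z1 < 1}` onto the open quarter disc `Q = {0 < X, 0 < Z, X² + Z² < 1}` with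
Jacobian determinant `√(1 − z1²)·(1 + z0²)^{-3/2}`. Since `1 − X² − Z² = (1 − z1²)/(1 + z0²)`
along `Θ`, the pull-back of the octant-area density `(1 − X² − Z²)^{-1/2}` is `1/(1 + z0²)`,
whence `[Q, (1 − X² − Z²)^{-1/2}] ~ [H, 1/(1 + z0²)]`.

Everything is written with explicit terms (no new definitions). Auxiliary material (namespace
`…LegendreAllModuliLine.M3`): injectivity / image / Fréchet derivative and determinant / pull-back
identity / `ℚ`-semialgebraicity of `Θ`, and the existence of the source representation
`[H, 1/(1 + z0²)]` (`exists_stripRep`: `H` semialgebraic, the integrand a quotient of polynomials,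
integrable on the slab `ℝ × [0,1]` by Fubini). The strip material and the shape of the derivative
and change-of-variables proofs are adapted from the sibling crux's evidence file
`Cruxes/GpcLegendreLemniscatic/DrefuteLineStubs.lean` (§A, §B, §D).
-/

noncomputable section

open MeasureTheory Set
open Literature.NumberTheory.Transcendental
open Literature.NumberTheory.Transcendental.KZ
open Literature.ModelTheory.ExponentialFields (IsSemialgebraic)
open MvPolynomial (aeval X C)
open Summit.KontsevichZagierPeriods.Grothendieck.GpcLegendreLemniscaticNegative

namespace Summit.KontsevichZagierPeriods.UnfoldedStokes.LegendreAllModuliLine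

namespace M3

/-! ## Pointwise algebra of the substitution `θ z = z0·√(1 − z1²)/√(1 + z0²)` -/

/-- First coordinate of `update z 0 v`. [folklore] -/
theorem update_apply_zero (z : Fin 2 → ℝ) (v : ℝ) : Function.update z 0 v 0 = v := by
  simp

/-- Second coordinate of `update z 0 v`. [folklore] -/
theorem update_apply_one (z : Fin 2 → ℝ) (v : ℝ) : Function.update z 0 v 1 = z 1 := by
  simp

/-- On `(0,1)`, `1 − t² > 0`. [folklore] -/
theorem one_sub_sq_pos {t : ℝ} (h0 : 0 < t) (h1 : t < 1) : 0 < 1 - t ^ 2 := by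
  nlinarith

/-- `θ² = z0²(1 − z1²)/(1 + z0²)` when `z1² < 1`. [folklore] -/
theorem theta_sq (z : Fin 2 → ℝ) (hA : 0 < 1 - z 1 ^ 2) :
    (z 0 * Real.sqrt (1 - z 1 ^ 2) / Real.sqrt (1 + z 0 ^ 2)) ^ 2 =
      z 0 ^ 2 * (1 - z 1 ^ 2) / (1 + z 0 ^ 2) := by
  rw [div_pow, mul_pow, Real.sq_sqrt hA.le, Real.sq_sqrt (by positivity)]

/-- `1 − θ² − z1² = (1 − z1²)/(1 + z0²)` along the substitution. [folklore] -/
theorem one_sub_theta_sq (z : Fin 2 → ℝ) (hA : 0 < 1 - z 1 ^ 2) :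
    1 - (z 0 * Real.sqrt (1 - z 1 ^ 2) / Real.sqrt (1 + z 0 ^ 2)) ^ 2 - z 1 ^ 2 =
      (1 - z 1 ^ 2) / (1 + z 0 ^ 2) := by
  have hB : (1 + z 0 ^ 2) ≠ 0 := by positivity
  rw [theta_sq z hA]
  field_simp
  ring

/-- The pull-back identity: `1/(1 + z0²) = (1 − θ² − z1²)^{-1/2} · |√(1 − z1²)/((1 + z0²)√(1 + z0²))|`.
[folklore] -/
theorem pullback_identity (z : Fin 2 → ℝ) (hA : 0 < 1 - z 1 ^ 2) :
    1 / (1 + z 0 ^ 2) =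
      1 / Real.sqrt (1 - (z 0 * Real.sqrt (1 - z 1 ^ 2) / Real.sqrt (1 + z 0 ^ 2)) ^ 2 - z 1 ^ 2) *
        |Real.sqrt (1 - z 1 ^ 2) / ((1 + z 0 ^ 2) * Real.sqrt (1 + z 0 ^ 2))| := by
  have hB : 0 < 1 + z 0 ^ 2 := by positivity
  have hsA : 0 < Real.sqrt (1 - z 1 ^ 2) := Real.sqrt_pos.2 hA
  have hsB : 0 < Real.sqrt (1 + z 0 ^ 2) := Real.sqrt_pos.2 hB
  have hsA' : Real.sqrt (1 - z 1 ^ 2) ≠ 0 := hsA.ne'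
  have hsB' : Real.sqrt (1 + z 0 ^ 2) ≠ 0 := hsB.ne'
  have hB' : 1 + z 0 ^ 2 ≠ 0 := hB.ne'
  rw [one_sub_theta_sq z hA, Real.sqrt_div hA.le, abs_of_pos (by positivity)]
  field_simp

/-! ## Injectivity and image of `Θ z = update z 0 (θ z)` on the half-strip -/

/-- `Θ` maps the half-strip `H` into the quarter disc `Q`. [folklore] -/
theorem mapsTo_Theta :
    MapsTo (fun z : Fin 2 → ℝ =>
        Function.update z 0 (z 0 * Real.sqrt (1 - z 1 ^ 2) / Real.sqrt (1 + z 0 ^ 2)))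
      {z : Fin 2 → ℝ | 0 < z 0 ∧ 0 < z 1 ∧ z 1 < 1}
      {w : Fin 2 → ℝ | 0 < w 0 ∧ 0 < w 1 ∧ w 0 ^ 2 + w 1 ^ 2 < 1} := by
  rintro z ⟨h0, h1, h1'⟩
  have hA := one_sub_sq_pos h1 h1'
  refine ⟨?_, ?_, ?_⟩
  · simpa using div_pos (mul_pos h0 (Real.sqrt_pos.2 hA)) (Real.sqrt_pos.2 (by positivity))
  · simpa using h1
  · simp only [update_apply_zero, update_apply_one]
    have h := one_sub_theta_sq z hA
    have hpos : 0 < (1 - z 1 ^ 2) / (1 + z 0 ^ 2) := div_pos hA (by positivity)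
    linarith

/-- `Θ` is injective on `H` (`z1` is kept, and `s ↦ s/√(1 + s²)` is injective on `(0,∞)`).
[folklore] -/
theorem injOn_Theta :
    InjOn (fun z : Fin 2 → ℝ =>
        Function.update z 0 (z 0 * Real.sqrt (1 - z 1 ^ 2) / Real.sqrt (1 + z 0 ^ 2)))
      {z : Fin 2 → ℝ | 0 < z 0 ∧ 0 < z 1 ∧ z 1 < 1} := by
  rintro z ⟨h0, h1, h1'⟩ z' ⟨h0', -, -⟩ h
  have e1 : z 1 = z' 1 := by simpa using congrFun h 1
  have e0 : z 0 * Real.sqrt (1 - z 1 ^ 2) / Real.sqrt (1 + z 0 ^ 2) =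
      z' 0 * Real.sqrt (1 - z' 1 ^ 2) / Real.sqrt (1 + z' 0 ^ 2) := by
    simpa using congrFun h 0
  have hA := one_sub_sq_pos h1 h1'
  have hA' : 0 < 1 - z' 1 ^ 2 := by rw [← e1]; exact hA
  have hsq := congrArg (fun x : ℝ => x ^ 2) e0
  rw [theta_sq z hA, theta_sq z' hA', ← e1,
    div_eq_div_iff (by positivity) (by positivity)] at hsq
  have h00 : z 0 ^ 2 = z' 0 ^ 2 := by
    have : (z 0 ^ 2 - z' 0 ^ 2) * (1 - z 1 ^ 2) = 0 := by linear_combination hsq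
    rcases mul_eq_zero.1 this with h | h
    · linarith
    · exact absurd h hA.ne'
  have hy : z 0 = z' 0 := (pow_left_inj₀ h0.le h0'.le (by norm_num : (2:ℕ) ≠ 0)).1 h00
  funext i
  fin_cases i
  · exact hy
  · exact e1

/-- `Θ` maps `H` onto `Q`: the preimage of `w` is `(w0/√(1 − w0² − w1²), w1)`. [folklore] -/
theorem surjOn_Theta :
    SurjOn (fun z : Fin 2 → ℝ =>
        Function.update z 0 (z 0 * Real.sqrt (1 - z 1 ^ 2) / Real.sqrt (1 + z 0 ^ 2)))
      {z : Fin 2 → ℝ | 0 < z 0 ∧ 0 < z 1 ∧ z 1 < 1}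
      {w : Fin 2 → ℝ | 0 < w 0 ∧ 0 < w 1 ∧ w 0 ^ 2 + w 1 ^ 2 < 1} := by
  rintro w ⟨hw0, hw1, hw2⟩
  have hR : 0 < 1 - w 0 ^ 2 - w 1 ^ 2 := by linarith
  have hA : 0 < 1 - w 1 ^ 2 := by nlinarith
  have hsR : 0 < Real.sqrt (1 - w 0 ^ 2 - w 1 ^ 2) := Real.sqrt_pos.2 hR
  have hsR' : Real.sqrt (1 - w 0 ^ 2 - w 1 ^ 2) ≠ 0 := hsR.ne'
  have hsA' : Real.sqrt (1 - w 1 ^ 2) ≠ 0 := (Real.sqrt_pos.2 hA).ne'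
  have hw1' : w 1 < 1 := by nlinarith
  refine ⟨![w 0 / Real.sqrt (1 - w 0 ^ 2 - w 1 ^ 2), w 1], ⟨?_, ?_, ?_⟩, ?_⟩
  · simpa using div_pos hw0 hsR
  · simpa using hw1
  · simpa using hw1'
  have h1s : 1 + (w 0 / Real.sqrt (1 - w 0 ^ 2 - w 1 ^ 2)) ^ 2 =
      (1 - w 1 ^ 2) / (1 - w 0 ^ 2 - w 1 ^ 2) := by
    rw [div_pow, Real.sq_sqrt hR.le]
    field_simp
    ring
  have hth : w 0 / Real.sqrt (1 - w 0 ^ 2 - w 1 ^ 2) * Real.sqrt (1 - w 1 ^ 2) /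
      Real.sqrt (1 + (w 0 / Real.sqrt (1 - w 0 ^ 2 - w 1 ^ 2)) ^ 2) = w 0 := by
    rw [h1s, Real.sqrt_div hA.le]
    field_simp
  funext i
  fin_cases i
  · simpa using hth
  · simp

/-! ## The Fréchet derivative of `Θ` and its determinant -/

/-- At `z ∈ H`, `Θ` has a Fréchet derivative whose determinant is
`∂θ/∂z0 = √(1 − z1²)/((1 + z0²)√(1 + z0²))` (the Jacobian matrix is triangular). [folklore] -/
theorem hasFDerivAt_Theta (z : Fin 2 → ℝ) (hz : z ∈ {z : Fin 2 → ℝ | 0 < z 0 ∧ 0 < z 1 ∧ z 1 < 1}) :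
    ∃ L : (Fin 2 → ℝ) →L[ℝ] (Fin 2 → ℝ),
      HasFDerivAt (fun z : Fin 2 → ℝ =>
          Function.update z 0 (z 0 * Real.sqrt (1 - z 1 ^ 2) / Real.sqrt (1 + z 0 ^ 2))) L z ∧
        L.det = Real.sqrt (1 - z 1 ^ 2) / ((1 + z 0 ^ 2) * Real.sqrt (1 + z 0 ^ 2)) := by
  have hA : 0 < 1 - z 1 ^ 2 := one_sub_sq_pos hz.2.1 hz.2.2
  have hB : 0 < 1 + z 0 ^ 2 := by positivity
  have hsA : 0 < Real.sqrt (1 - z 1 ^ 2) := Real.sqrt_pos.2 hA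
  have hsB : 0 < Real.sqrt (1 + z 0 ^ 2) := Real.sqrt_pos.2 hB
  -- coordinate projections
  set P0 : (Fin 2 → ℝ) →L[ℝ] ℝ := ContinuousLinearMap.proj (R := ℝ) (φ := fun _ : Fin 2 => ℝ) 0
    with hP0
  set P1 : (Fin 2 → ℝ) →L[ℝ] ℝ := ContinuousLinearMap.proj (R := ℝ) (φ := fun _ : Fin 2 => ℝ) 1
    with hP1
  have hp0 : HasFDerivAt (fun v : Fin 2 → ℝ => v 0) P0 z := hasFDerivAt_apply 0 z
  have hp1 : HasFDerivAt (fun v : Fin 2 → ℝ => v 1) P1 z := hasFDerivAt_apply 1 z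
  -- `1 - v1²`, `1 + v0²`, their square roots, and the inverse of the latter
  have hAd : HasFDerivAt (fun v : Fin 2 → ℝ => 1 - v 1 ^ 2) (-(((2:ℕ) • z 1 ^ (2 - 1)) • P1)) z :=
    (hp1.pow 2).const_sub 1
  have hBd : HasFDerivAt (fun v : Fin 2 → ℝ => 1 + v 0 ^ 2) (((2:ℕ) • z 0 ^ (2 - 1)) • P0) z :=
    (hp0.pow 2).const_add 1
  set LA : (Fin 2 → ℝ) →L[ℝ] ℝ :=
    (1 / (2 * Real.sqrt (1 - z 1 ^ 2))) • -(((2:ℕ) • z 1 ^ (2 - 1)) • P1) with hLA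
  have hsAd : HasFDerivAt (fun v : Fin 2 → ℝ => Real.sqrt (1 - v 1 ^ 2)) LA z := hAd.sqrt hA.ne'
  set LB : (Fin 2 → ℝ) →L[ℝ] ℝ :=
    (1 / (2 * Real.sqrt (1 + z 0 ^ 2))) • (((2:ℕ) • z 0 ^ (2 - 1)) • P0) with hLB
  have hsBd : HasFDerivAt (fun v : Fin 2 → ℝ => Real.sqrt (1 + v 0 ^ 2)) LB z := hBd.sqrt hB.ne'
  set LI : (Fin 2 → ℝ) →L[ℝ] ℝ := (-(Real.sqrt (1 + z 0 ^ 2) ^ 2)⁻¹) • LB with hLI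
  have hinv : HasFDerivAt (fun v : Fin 2 → ℝ => (Real.sqrt (1 + v 0 ^ 2))⁻¹) LI z :=
    (hasDerivAt_inv hsB.ne').comp_hasFDerivAt z hsBd
  -- the numerator `v0 · √(1 - v1²)` and `θ = numerator · (√(1 + v0²))⁻¹`
  set LN : (Fin 2 → ℝ) →L[ℝ] ℝ := z 0 • LA + Real.sqrt (1 - z 1 ^ 2) • P0 with hLN
  have hN : HasFDerivAt (fun v : Fin 2 → ℝ => v 0 * Real.sqrt (1 - v 1 ^ 2)) LN z :=
    hp0.fun_mul hsAd
  set L0 : (Fin 2 → ℝ) →L[ℝ] ℝ :=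
    (z 0 * Real.sqrt (1 - z 1 ^ 2)) • LI + (Real.sqrt (1 + z 0 ^ 2))⁻¹ • LN with hL0
  have hθ : HasFDerivAt
      (fun v : Fin 2 → ℝ => v 0 * Real.sqrt (1 - v 1 ^ 2) / Real.sqrt (1 + v 0 ^ 2)) L0 z := by
    have hmul := hN.fun_mul hinv
    have hfun : (fun v : Fin 2 → ℝ => v 0 * Real.sqrt (1 - v 1 ^ 2) / Real.sqrt (1 + v 0 ^ 2)) =
        fun v : Fin 2 → ℝ => v 0 * Real.sqrt (1 - v 1 ^ 2) * (Real.sqrt (1 + v 0 ^ 2))⁻¹ := by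
      funext v
      rw [div_eq_mul_inv]
    rw [hfun]
    exact hmul
  -- assemble the derivative of `Θ = (θ, z1)`
  set F : Fin 2 → ((Fin 2 → ℝ) →L[ℝ] ℝ) := Fin.cons L0 (Fin.cons P1 finZeroElim) with hF
  have hF0 : F 0 = L0 := rfl
  have hF1 : F 1 = P1 := rfl
  refine ⟨ContinuousLinearMap.pi F, ?_, ?_⟩
  · apply hasFDerivAt_pi''
    intro i
    fin_cases i
    · simp only [Fin.zero_eta, ContinuousLinearMap.proj_pi, hF0, update_apply_zero]
      exact hθ
    · simp only [Fin.mk_one, ContinuousLinearMap.proj_pi, hF1, update_apply_one]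
      exact hp1
  · -- the determinant, via the `2 × 2` matrix in the standard basis
    show LinearMap.det ((ContinuousLinearMap.pi F : (Fin 2 → ℝ) →L[ℝ] (Fin 2 → ℝ)) :
        (Fin 2 → ℝ) →ₗ[ℝ] (Fin 2 → ℝ)) = _
    rw [← LinearMap.det_toMatrix', Matrix.det_fin_two]
    simp only [LinearMap.toMatrix'_apply, ContinuousLinearMap.coe_coe, ContinuousLinearMap.pi_apply,
      hF0, hF1, hL0, hLN, hLA, hLI, hLB, hP0, hP1]
    have hB2 : Real.sqrt (1 + z 0 ^ 2) ^ 2 = 1 + z 0 ^ 2 := Real.sq_sqrt hB.le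
    simp [hB2]
    field_simp
    ring

/-! ## Semialgebraicity -/

/-- `Θ` is a `ℚ`-semialgebraic map on the (semialgebraic) half-strip `H`: its coordinates are
`z0·√(1 − z1²)/√(1 + z0²)` (products, quotients and square roots of polynomials) and `z1`.
[folklore] -/
theorem isSemialgebraicMapOn_Theta
    (hH : IsSemialgebraic ℚ {z : Fin 2 → ℝ | 0 < z 0 ∧ 0 < z 1 ∧ z 1 < 1}) :
    IsSemialgebraicMapOn ℚ {z : Fin 2 → ℝ | 0 < z 0 ∧ 0 < z 1 ∧ z 1 < 1} (fun z : Fin 2 → ℝ =>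
      Function.update z 0 (z 0 * Real.sqrt (1 - z 1 ^ 2) / Real.sqrt (1 + z 0 ^ 2))) := by
  refine IsSemialgebraicMapOn.of_forall hH fun j => ?_
  fin_cases j
  · simp only [Fin.zero_eta, update_apply_zero]
    have h0 := isSemialgebraicFunOn_aeval hH (X 0 : MvPolynomial (Fin 2) ℚ)
    have hA := IsSemialgebraicFunOn.sqrt_holds
      (isSemialgebraicFunOn_aeval hH (1 - X 1 ^ 2 : MvPolynomial (Fin 2) ℚ))
    have hB := IsSemialgebraicFunOn.sqrt_holds
      (isSemialgebraicFunOn_aeval hH (1 + X 0 ^ 2 : MvPolynomial (Fin 2) ℚ))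
    refine (((IsSemialgebraicFunOn.mul_holds h0 hA).div hB) fun z _ => ?_).congr fun z _ => ?_
    · simp only [map_add, map_one, map_pow, MvPolynomial.aeval_X]
      exact (Real.sqrt_pos.2 (by positivity)).ne'
    · simp
  · simp only [Fin.mk_one, update_apply_one]
    exact (isSemialgebraicFunOn_aeval hH (X 1 : MvPolynomial (Fin 2) ℚ)).congr fun z _ => by simp

/-! ## The source representation `[H, 1/(1 + z0²)]` -/

-- adapted from Cruxes/GpcLegendreLemniscatic/DrefuteLineStubs.lean §B
-- (`isSemialgebraic_stripSet`, `isSemialgebraicFunOn_gStrip`, `integrableOn_gStrip_slab`, `stripRep`)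
/-- The SOURCE of the move exists: a representation with domain the half-strip `H` (which is
`ℚ`-semialgebraic) and integrand `1/(1 + z0²)` (a quotient of `ℚ`-polynomials, integrable on the
slab `ℝ × [0,1] ⊇ H` by Fubini: `∫ dx/(1 + x²) · 1`). [folklore] -/
theorem exists_stripRep :
    ∃ s : IntegralRep 2, s.domain = {z : Fin 2 → ℝ | 0 < z 0 ∧ 0 < z 1 ∧ z 1 < 1} ∧
      s.integrand = fun z => 1 / (1 + z 0 ^ 2) := by
  -- `H` is `ℚ`-semialgebraic
  have hH : IsSemialgebraic ℚ {z : Fin 2 → ℝ | 0 < z 0 ∧ 0 < z 1 ∧ z 1 < 1} := by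
    have h0 : IsSemialgebraic ℚ {z : Fin 2 → ℝ | 0 < z 0} := by
      simpa using Literature.ModelTheory.ExponentialFields.isSemialgebraic_setOf_eval_lt (k := ℚ)
        (R := ℝ) (0 : MvPolynomial (Fin 2) ℚ) (X 0)
    have h1 : IsSemialgebraic ℚ {z : Fin 2 → ℝ | 0 < z 1} := by
      simpa using Literature.ModelTheory.ExponentialFields.isSemialgebraic_setOf_eval_lt (k := ℚ)
        (R := ℝ) (0 : MvPolynomial (Fin 2) ℚ) (X 1)
    have h2 : IsSemialgebraic ℚ {z : Fin 2 → ℝ | z 1 < 1} := by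
      simpa using Literature.ModelTheory.ExponentialFields.isSemialgebraic_setOf_eval_lt (k := ℚ)
        (R := ℝ) (X 1 : MvPolynomial (Fin 2) ℚ) 1
    convert h0.inter (h1.inter h2) using 1
    ext z
    simp
  -- the integrand is a `ℚ`-semialgebraic function on `H`
  have hg : IsSemialgebraicFunOn ℚ {z : Fin 2 → ℝ | 0 < z 0 ∧ 0 < z 1 ∧ z 1 < 1}
      (fun z : Fin 2 → ℝ => 1 / (1 + z 0 ^ 2)) := by
    have h := isSemialgebraicFunOn_aeval_div_aeval hH (1 : MvPolynomial (Fin 2) ℚ) (1 + X 0 ^ 2)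
      (fun x _ => by
        simp only [map_add, map_one, map_pow, MvPolynomial.aeval_X]
        positivity)
    exact h.congr fun x _ => by simp only [map_add, map_one, map_pow, MvPolynomial.aeval_X]
  -- the integrand is integrable on the slab `ℝ × [0,1]`
  have hint : IntegrableOn (fun z : Fin 2 → ℝ => 1 / (1 + z 0 ^ 2))
      {z : Fin 2 → ℝ | 0 ≤ z 1 ∧ z 1 ≤ 1} := by
    have hf : Integrable (fun t : ℝ => (1 + t ^ 2)⁻¹) := integrable_inv_one_add_sq
    have hc : Integrable (fun _ : ℝ => (1:ℝ)) (volume.restrict (Icc (0:ℝ) 1)) := integrable_const 1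
    have hprod : IntegrableOn (fun p : ℝ × ℝ => (1 + p.1 ^ 2)⁻¹ * 1) (univ ×ˢ Icc (0:ℝ) 1)
        (volume : Measure (ℝ × ℝ)) := by
      rw [Measure.volume_eq_prod, IntegrableOn, ← Measure.prod_restrict, Measure.restrict_univ]
      exact hf.mul_prod hc
    have he := (MeasureTheory.volume_preserving_finTwoArrow ℝ).integrableOn_comp_preimage
      (MeasurableEquiv.measurableEmbedding _) (f := fun p : ℝ × ℝ => (1 + p.1 ^ 2)⁻¹ * 1)
      (s := univ ×ˢ Icc (0:ℝ) 1)
    have h2 := he.mpr hprod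
    have hset : (MeasurableEquiv.finTwoArrow : (Fin 2 → ℝ) ≃ᵐ ℝ × ℝ) ⁻¹' (univ ×ˢ Icc (0:ℝ) 1) =
        {z : Fin 2 → ℝ | 0 ≤ z 1 ∧ z 1 ≤ 1} := by
      ext z
      simp [MeasurableEquiv.finTwoArrow_apply]
    rw [hset] at h2
    refine h2.congr_fun (fun z _ => ?_) ?_
    · simp [MeasurableEquiv.finTwoArrow_apply, one_div]
    · have : {z : Fin 2 → ℝ | 0 ≤ z 1 ∧ z 1 ≤ 1} = (fun z : Fin 2 → ℝ => z 1) ⁻¹' Icc 0 1 := by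
        ext z; simp
      rw [this]
      exact measurableSet_Icc.preimage (measurable_pi_apply 1)
  exact ⟨⟨_, _, hH, hg, hint.mono_set fun _ hz => ⟨hz.2.1.le, hz.2.2.le⟩⟩, rfl, rfl⟩

/-! ## The change of variables and the stub -/

-- adapted from Cruxes/GpcLegendreLemniscatic/DrefuteLineStubs.lean §D (`stub_conicPencil_proof`)
/-- ONE change of variables along `Θ`: `[s] − [p] ∈ relations` for every representation `s` with
domain `H` and integrand `1/(1 + z0²)` and every representation `p` with domain `Q` whose
integrand is `(1 − X² − Z²)^{-1/2}` on `Q`. [cite: KontsevichZagier2001, §1.2 rule (2)] -/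
theorem of_sub_of_mem_relations (s : IntegralRep 2)
    (hsd : s.domain = {z : Fin 2 → ℝ | 0 < z 0 ∧ 0 < z 1 ∧ z 1 < 1})
    (hsi : s.integrand = fun z => 1 / (1 + z 0 ^ 2)) (p : IntegralRep 2)
    (hpd : p.domain = {w : Fin 2 → ℝ | 0 < w 0 ∧ 0 < w 1 ∧ w 0 ^ 2 + w 1 ^ 2 < 1})
    (hpi : EqOn p.integrand (fun w => 1 / Real.sqrt (1 - w 0 ^ 2 - w 1 ^ 2))
      {w : Fin 2 → ℝ | 0 < w 0 ∧ 0 < w 1 ∧ w 0 ^ 2 + w 1 ^ 2 < 1}) :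
    of s - of p ∈ relations := by
  classical
  have hH : IsSemialgebraic ℚ {z : Fin 2 → ℝ | 0 < z 0 ∧ 0 < z 1 ∧ z 1 < 1} := by
    rw [← hsd]
    exact s.isSemialgebraic_domain
  choose L hL using hasFDerivAt_Theta
  apply changeOfVariablesRel_subset_relations
  refine ⟨2, s, p, fun z : Fin 2 → ℝ =>
      Function.update z 0 (z 0 * Real.sqrt (1 - z 1 ^ 2) / Real.sqrt (1 + z 0 ^ 2)),
    fun z => if h : z ∈ {z : Fin 2 → ℝ | 0 < z 0 ∧ 0 < z 1 ∧ z 1 < 1} then L z h else 0,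
    ?_, ?_, ?_, ?_, ?_, rfl⟩
  · rw [hsd]
    exact isSemialgebraicMapOn_Theta hH
  · intro z hz
    rw [hsd] at hz ⊢
    simp only [dif_pos hz]
    exact (hL z hz).1.hasFDerivWithinAt
  · rw [hsd]
    exact injOn_Theta
  · rw [hpd, hsd]
    exact (surjOn_Theta.image_eq_of_mapsTo mapsTo_Theta).symm
  · intro z hz
    rw [hsd] at hz
    have hA : 0 < 1 - z 1 ^ 2 := one_sub_sq_pos hz.2.1 hz.2.2
    have hQ : Function.update z 0 (z 0 * Real.sqrt (1 - z 1 ^ 2) / Real.sqrt (1 + z 0 ^ 2)) ∈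
        {w : Fin 2 → ℝ | 0 < w 0 ∧ 0 < w 1 ∧ w 0 ^ 2 + w 1 ^ 2 < 1} := mapsTo_Theta hz
    simp only [hsi, dif_pos hz, (hL z hz).2]
    rw [hpi hQ]
    simp only [update_apply_zero, update_apply_one]
    exact pullback_identity z hA

end M3

open M3 in
/-- **M3, quarter disc to half-strip**: ONE rule-(2) move along the one-coordinate substitution
`Θ z = update z 0 (z0·√(1 − z1²)/√(1 + z0²))`, a bijection of the half-strip
`H = {0 < z0} ∩ {0 < z1 < 1}` onto the quarter disc `Q` with Jacobian `√(1−z1²)·(1+z0²)^{-3/2}`;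
since `1 − X² − Z² = (1 − z1²)/(1 + z0²)` along `Θ`, the pulled-back density is `1/(1 + z0²)`:
`[Q, (1−X²−Z²)^{-1/2}] ~ [H, 1/(1+z0²)]`. [cite: KontsevichZagier2001, §1.2 rule (2)] -/
theorem stub_discToStrip :
    ∀ p : IntegralRep 2, p.domain = {w : Fin 2 → ℝ | 0 < w 0 ∧ 0 < w 1 ∧ w 0 ^ 2 + w 1 ^ 2 < 1} →
      EqOn p.integrand (fun w => 1 / Real.sqrt (1 - w 0 ^ 2 - w 1 ^ 2))
        {w : Fin 2 → ℝ | 0 < w 0 ∧ 0 < w 1 ∧ w 0 ^ 2 + w 1 ^ 2 < 1} →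
      ∃ s : IntegralRep 2, s.domain = {z : Fin 2 → ℝ | 0 < z 0 ∧ 0 < z 1 ∧ z 1 < 1} ∧
        EqOn s.integrand (fun z => 1 / (1 + z 0 ^ 2)) {z : Fin 2 → ℝ | 0 < z 0 ∧ 0 < z 1 ∧ z 1 < 1} ∧
        Equivalent p s := by
  intro p hpd hpi
  obtain ⟨s, hsd, hsi⟩ := exists_stripRep
  have h : Equivalent s p := of_sub_of_mem_relations s hsd hsi p hpd hpi
  exact ⟨s, hsd, fun z _ => congrFun hsi z, h.symm⟩

end Summit.KontsevichZagierPeriods.UnfoldedStokes.LegendreAllModuliLine
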